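import Summits.ResolutionOfSingularities.ResolutionOfSingularities.Theorems.HomologicalConductorCurveStep
import Summits.ResolutionOfSingularities.ResolutionOfSingularities.Theorems.HomologicalConductorNoZenoTowerNoetherian
import Literature.RingTheory.CohomologyAnnihilator.RegularLocalRing
import HarnessLib

/-!
# `Persistence` in dimension `≤ 1` (rung S-1 `PersistenceDimOne` of chain W4.4b)

Crux `HomologicalConductor.Persistence` (stmt-ResolutionOfSingularities-16484); plan of record
`L/w44b/CHAIN.md` v0.1 §2.3 S-1. The crux restricted to curves (`ringKrullDim A ≤ 1`), verbatim
the route binders with one extra hypothesis: along the canonical normalised `ca`-tower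
`T₀ = loc A`, `T_(m+1) = loc (nrm (chart T_m))` of a finitely generated `A ⊆ O ⊆ K = Frac A` of
Krull dimension `≤ 1`, **`ca (T_m) ⊆ ca (T_(m+1))` for every `m`**, unconditionally.

Proof (composition of landed route lemmas; no use of Iyengar–Takahashi 2014 Thm 5.4): every stage
`T_(m+1)` with `m + 1 ≥ 1` is a regular local ring — if `T_m` is regular the tower is stationary
(`NoZeno.Birth.tower_succ_eq_self_of_isRegularLocalRing`), and if `T_m` is singular (of dimension
`≤ dim A ≤ 1`, `StrictDrop.Birth.CurveCase.ringKrullDim_subalgebra_le_of_affineModel`) the next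
stage is a normal noetherian local domain of dimension `≤ 1` (Krull–Akizuki,
`StrictDrop.Birth.DimLEOne.stub_dimLEOne_succ_regular`, fed by `StrictDrop.Birth.TowerShape`);
and a regular local stage has `ca = ⊤` ([IyengarTakahashi2014, Example 2.5],
`cohomologyAnnihilator_eq_top_of_isRegularLocalRing`), so `ca (T_m) ⊆ T_m ⊆ T_(m+1) = ca (T_(m+1))`.
The same argument is tri-2's sorry-free triage instrument `TriageDimOne.persistence_dimOne`
(L/res-L1-w44b-tri-2/DimOne.lean, `dim A = 1`); here `dim A ≤ 1` and through the gate.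
`[OURS · L1 w44b]` — a rung of OUR route, not a statement of any manuscript.

References: H. Matsumura, *Commutative Ring Theory*, Thm. 11.7 (Krull–Akizuki) [`Matsumura1987`];
S. B. Iyengar, R. Takahashi, IMRN 2016, Example 2.5 [`IyengarTakahashi2014`].
-/

noncomputable section

-- single-problem summit: the doubled namespace component is forced
set_option linter.dupNamespace false

namespace Summit.ResolutionOfSingularities.ResolutionOfSingularities.Theorems.HomologicalConductor.PersistenceDimOne

open Summit.ResolutionOfSingularities.ResolutionOfSingularities.Theses.HomologicalConductor
open Summit.ResolutionOfSingularities.ResolutionOfSingularities.Theorems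
open Summit.ResolutionOfSingularities.ResolutionOfSingularities.Theorems.NoZeno.Birth
  (ca loc chart nrm tower tower_succ ca_subset tn_coe_mem_ca_iff tower_succ_eq_self_of_isRegularLocalRing)
open Literature.RingTheory.CohomologyAnnihilator (cohomologyAnnihilator_eq_top_of_isRegularLocalRing)

variable {k K : Type} [Field k] [Field K] [Algebra k K]

/-- A regular local stage has `ca T = T` (as subsets of `K`): the cohomology annihilator of a
regular local ring is the unit ideal. [cite: IyengarTakahashi2014, Example 2.5] -/
theorem ca_eq_self_of_isRegularLocalRing (T : Subalgebra k K) (hreg : IsRegularLocalRing ↥T) :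
    ca T = (T : Set K) := by
  haveI := hreg
  refine Set.Subset.antisymm (ca_subset T) fun x hx => ?_
  have htop := cohomologyAnnihilator_eq_top_of_isRegularLocalRing ↥T
  exact (tn_coe_mem_ca_iff T ⟨x, hx⟩).mpr (by rw [htop]; trivial)

/-- **Every stage after the first is regular in dimension `≤ 1`.** For `A` finitely generated with
`Frac A = K`, `A ⊆ O`, `dim A ≤ 1`: `T_(m+1)` is a regular local ring for every `m` — `T_m` regular
makes the tower stationary, `T_m` singular of dimension `≤ 1` is followed by a normal noetherian
local domain of dimension `≤ 1` (Krull–Akizuki). [cite: Matsumura1987, Thm. 11.7] -/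
theorem succ_isRegularLocalRing_of_ringKrullDim_le_one : ∀ p : ℕ, p.Prime → ∀ (k K : Type) [Field k] [CharP k p] [Field K] [Algebra k K] (O : ValuationSubring K) (A : Subalgebra k K), (∀ c : k, algebraMap k K c ∈ O) → A.FG → IsFractionRing ↥A K → A.toSubring ≤ O.toSubring → ringKrullDim ↥A ≤ 1 → let ca : Subalgebra k K → Set K := fun A => {x : K | ∃ hx : x ∈ A, ∃ n : ℕ, ∀ i : ℕ, n ≤ i → ∀ (M N : ModuleCat.{0} ↥A), Module.Finite ↥A M → Module.Finite ↥A N → ∀ e : CategoryTheory.Abelian.Ext.{0} M N i, (⟨x, hx⟩ : ↥A) • e = 0}; let loc : Subalgebra k K → Subalgebra k K := fun A => Algebra.adjoin k {y : K | ∃ a ∈ A, ∃ s ∈ A, s⁻¹ ∈ O ∧ y = a * s⁻¹}; let chart : Subalgebra k K → Subalgebra k K := fun A => Algebra.adjoin k ((A : Set K) ∪ {y : K | ∃ c ∈ ca A, ∃ x ∈ ca A, x ≠ 0 ∧ (∀ c' ∈ ca A, c' * x⁻¹ ∈ O) ∧ y = c * x⁻¹}); let nrm : Subalgebra k K → Subalgebra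 k K := fun B => Algebra.adjoin k {y : K | IsIntegral ↥B y}; let tower : Subalgebra k K → ℕ → Subalgebra k K := fun A m => @Nat.rec (fun _ => Subalgebra k K) (loc A) (fun _ B => loc (nrm (chart B))) m; ∀ m : ℕ, IsRegularLocalRing ↥(tower A (m + 1)) := by
  intro p hp k K _ _ _ _ O A hk hfg hfrac hle hdimA ca loc chart nrm tower m
  show IsRegularLocalRing ↥(NoZeno.Birth.tower O A (m + 1))
  have hshape := StrictDrop.Birth.TowerShape.stub_towerShape p hp k K O A hk hfg hfrac hle
  by_cases hreg : IsRegularLocalRing ↥(NoZeno.Birth.tower O A m)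
  · -- a regular stage is terminal: `T_(m+1) = T_m`
    rw [tower_succ_eq_self_of_isRegularLocalRing O A hk hfrac hle m hreg]
    exact hreg
  · -- a singular stage of dimension `≤ 1` is followed by a regular one (Krull–Akizuki)
    have hdim : ringKrullDim ↥(NoZeno.Birth.tower O A m) ≤ 1 :=
      (StrictDrop.Birth.CurveCase.ringKrullDim_subalgebra_le_of_affineModel A hfg hfrac
        (NoZeno.Birth.tower O A m)).trans hdimA
    exact StrictDrop.Birth.DimLEOne.stub_dimLEOne_succ_regular p hp k K O A hk hfg hfrac hle
      hshape m hdim hreg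

/-- **Rung S-1 `PersistenceDimOne`: the crux `Persistence` for `dim A ≤ 1`, unconditionally.**
Along the canonical normalised `ca`-tower of a finitely generated `A ⊆ O ⊆ K = Frac A` of Krull
dimension `≤ 1`, `ca (T_m) ⊆ ca (T_(m+1))` for every `m`: the stage `T_(m+1)` is regular
(`succ_isRegularLocalRing_of_ringKrullDim_le_one`), so `ca (T_(m+1)) = T_(m+1) ⊇ T_m ⊇ ca (T_m)` (the inclusion `T_m ≤ T_(m+1)` as in tri-2's
instrument). [cite: Matsumura1987, Thm. 11.7] -/
theorem persistence_of_ringKrullDim_le_one : ∀ p : ℕ, p.Prime → ∀ (k K : Type) [Field k] [CharP k p] [Field K] [Algebra k K] (O : ValuationSubring K) (A : Subalgebra k K), (∀ c : k, algebraMap k K c ∈ O) → A.FG → IsFractionRing ↥A K → A.toSubring ≤ O.toSubring → ringKrullDim ↥A ≤ 1 → let ca : Subalgebra k K → Set K := fun A => {x : K | ∃ hx : x ∈ A, ∃ n : ℕ, ∀ i : ℕ, n ≤ i → ∀ (M N : ModuleCat.{0} ↥A), Module.Finite ↥A M → Module.Finite ↥A N → ∀ e : CategoryTheory.Abelian.Ext.{0}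 M N i, (⟨x, hx⟩ : ↥A) • e = 0}; let loc : Subalgebra k K → Subalgebra k K := fun A => Algebra.adjoin k {y : K | ∃ a ∈ A, ∃ s ∈ A, s⁻¹ ∈ O ∧ y = a * s⁻¹}; let chart : Subalgebra k K → Subalgebra k K := fun A => Algebra.adjoin k ((A : Set K) ∪ {y : K | ∃ c ∈ ca A, ∃ x ∈ ca A, x ≠ 0 ∧ (∀ c' ∈ ca A, c' * x⁻¹ ∈ O) ∧ y = c * x⁻¹}); let nrm : Subalgebra k K → Subalgebra k K := fun B => Algebra.adjoin k {y : K | IsIntegral ↥B y}; let tower : Subalgebra k K → ℕ → Subalgebra k K := fun A m => @Nat.rec (fun _ => Subalgebra k K) (loc A) (fun _ B => loc (nrm (chart B))) m; ∀ m : ℕ, ca (tower A m) ⊆ ca (tower A (m + 1)) := by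
  intro p hp k K _ _ _ _ O A hk hfg hfrac hle hdimA ca loc chart nrm tower m
  show NoZeno.Birth.ca (NoZeno.Birth.tower O A m) ⊆ NoZeno.Birth.ca (NoZeno.Birth.tower O A (m + 1))
  have hreg : IsRegularLocalRing ↥(NoZeno.Birth.tower O A (m + 1)) :=
    succ_isRegularLocalRing_of_ringKrullDim_le_one p hp k K O A hk hfg hfrac hle hdimA m
  rw [ca_eq_self_of_isRegularLocalRing (NoZeno.Birth.tower O A (m + 1)) hreg]
  -- `ca (T_m) ⊆ T_m ≤ T_(m+1)` (the stage embeds in `loc (nrm (chart T_m))`)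
  intro x hx
  have hxT : x ∈ NoZeno.Birth.tower O A m := ca_subset _ hx
  rw [tower_succ]
  exact SyzygyFlattening.self_le_locAt O _ (SyzygyFlattening.self_le_nrm _
    (Algebra.subset_adjoin (Or.inl hxT)))

end Summit.ResolutionOfSingularities.ResolutionOfSingularities.Theorems.HomologicalConductor.PersistenceDimOne

end
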